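import Summits.AnomalousDissipation.AnomalousDissipation.Theorems.MomentParityQuarticGateRows
import Summits.AnomalousDissipation.AnomalousDissipation.Theorems.MomentParityQuarticGateFatten

/-!
# Order-3 surgery for `MomentParity.QuarticGate` (stmt-AnomalousDissipation-11464), helper VI:
# the shifted, inflated moment sequence ("Kernel")

Support file for the stub `stub_order3Surgery` of the line `recession-cone` (S5): the
construction of the target moment sequence `y_Λ = (1, M₁, M₂, M₃ + S, Λ·M₄)` of the order-3 surgery,
in a band basis `b` of the level-`N` Galerkin space, from

* the coordinate moments `y₀` of the given law `μ₀` (bounded support, nondegenerate covariance: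
  `Rows`), FATTENED to a strictly positive `y₁` with the same entries of degree `≤ 2` (`Fatten`);
* the row polynomials `Q_α` of the quadratic basis tests `x^α` (hypothesis `hRow`, the shape of
  infrastructure I4 `exists_rowPoly`), their cubic parts `c α = (Q_α)₃` and rows `a α = L_{y₁}(Q_α)`;
* the KERNEL STEP (`Rows`): `a` kills `ker cᵀ` by QuadRigidity and the vanishing energy/helicity
  rows, so `a = c s` (`QuadRange`) and the shift `S = -s` of the third moments kills every quadratic
  row; `Λ` from `LambdaPositivity`.

Output `exists_shifted_sequence`: `y_Λ` strictly positive in degree `4`, `y_Λ = y₀` up to degree `2`,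
and `L_{y_Λ}(Q) = 0` for the row polynomial `Q` of every homogeneous quadratic basis test.
-/

-- `Summit.<Summit>.<Problem>` is the tree's mandated summit-side namespace (CONVENTIONS §2); for this
-- single-conjunct summit the two coincide, so the duplicate is deliberate.
set_option linter.dupNamespace false

namespace Summit.AnomalousDissipation.AnomalousDissipation.Theorems.MomentParityQuarticGate

open scoped BigOperators InnerProductSpace RealInnerProductSpace ENNReal
open MeasureTheory MvPolynomial Literature.MeasureTheory.Moments
open Literature.Analysis.FunctionSpaces Literature.Analysis.FluidPDE
open Summit.AnomalousDissipation.AnomalousDissipation.Theorems.QuarticGate.Negative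

/-! ## Small bookkeeping -/

/-- The finite set of exponents of a given degree. [folklore] -/
theorem exists_finset_degree_eq (n k : ℕ) :
    ∃ T : Finset (Fin n →₀ ℕ), ∀ α, α ∈ T ↔ α.degree = k := by
  classical
  refine ⟨(Finsupp.finite_of_degree_le (σ := Fin n) k).toFinset.filter fun α => α.degree = k,
    fun α => ?_⟩
  simp only [Finset.mem_filter, Set.Finite.mem_toFinset, Set.mem_setOf_eq]
  constructor
  · exact fun h => h.2
  · exact fun h => ⟨h.le, h⟩

/-- A homogeneous quadratic polynomial is the combination of the degree-`2` monomials with its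
coefficients. [folklore] -/
theorem eq_sum_smul_monomial_of_isHomogeneous {n : ℕ} {T : Finset (Fin n →₀ ℕ)}
    (hT : ∀ α, α ∈ T ↔ α.degree = 2) (P : MvPolynomial (Fin n) ℝ) (hP : P.IsHomogeneous 2) :
    P = ∑ α : ↥T, P.coeff α.1 • monomial α.1 (1 : ℝ) := by
  classical
  refine MvPolynomial.ext _ _ fun β => ?_
  simp_rw [smul_monomial, smul_eq_mul, mul_one]
  rw [Literature.MeasureTheory.Moments.coeff_sum_monomial]
  split_ifs with hβ
  · rfl
  · exact hP.coeff_eq_zero fun h => hβ ((hT β).mpr h)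

/-- `L_y` of a polynomial of degree `≤ 3` splits into the part of degree `≤ 2` and the cubic
coefficients. [folklore] -/
theorem rieszFunctional_eq_of_degree_three {n : ℕ} (y y₁ S : (Fin n →₀ ℕ) → ℝ)
    (h2 : ∀ α : Fin n →₀ ℕ, α.degree + 1 ≤ 3 → y α = y₁ α)
    (h3 : ∀ α : Fin n →₀ ℕ, α.degree = 3 → y α = y₁ α + S α)
    (Q : MvPolynomial (Fin n) ℝ) (hQ : Q.totalDegree ≤ 3) :
    rieszFunctional y Q = rieszFunctional y₁ Q +
      ∑ β ∈ Q.support, if β.degree = 3 then Q.coeff β * S β else 0 := by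
  classical
  have hy : rieszFunctional y Q = rieszFunctional y (Q - homogeneousComponent 3 Q) +
      rieszFunctional y (homogeneousComponent 3 Q) := by
    rw [rieszFunctional_sub]; ring
  have hy₁ : rieszFunctional y₁ Q = rieszFunctional y₁ (Q - homogeneousComponent 3 Q) +
      rieszFunctional y₁ (homogeneousComponent 3 Q) := by
    rw [rieszFunctional_sub]; ring
  rw [hy, hy₁, rieszFunctional_sub_homogeneousComponent_congr h2 Q hQ,
    rieszFunctional_homogeneousComponent, rieszFunctional_homogeneousComponent, add_assoc,
    ← Finset.sum_add_distrib]
  congr 1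
  refine Finset.sum_congr rfl fun β _ => ?_
  split_ifs with h
  · rw [h3 β h]; ring
  · simp

/-! ## The shifted, inflated sequence -/

set_option maxHeartbeats 400000 in
/-- **The target sequence of the order-3 surgery.** Data: a family `b` of band tests whose
coordinate map `u ↦ ((u, bᵢ))ᵢ` is onto `ℝⁿ` from level-`N` fields and whose finite combinations are
band tests; a smooth force; a level-`N` law `μ₀` with bounded support, nondegenerate covariance and
vanishing energy and helicity rows; QuadRigidity at level `N` (for tests over `b`); and, for every
polynomial test over `b`, a row polynomial with the correct cubic top (the shape of I4). Conclusion: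
sequences `y₀` (the coordinate moments of `μ₀`) and `y_Λ` with `y_Λ 0 = 1`, `L_{y_Λ}` strictly
positive in degree `4`, `y_Λ = y₀` up to degree `2`, and `L_{y_Λ}(Q) = 0` for every polynomial `Q`
of degree `≤ 3` that computes the row of a homogeneous QUADRATIC test over `b` on level-`N` fields.
[folklore] -/
theorem exists_shifted_sequence :
    ∀ {N n : ℕ} {b : Fin n → UnitAddTorus (Fin 3) → EuclideanSpace ℝ (Fin 3)}, (∀ i, IsBandTest N (b
      i)) → (∀ ξ : Fin n → ℝ, IsBandTest N (fun x => ∑ i, ξ i • b i x)) → (∀ (u : Torus.energySpace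
      (Fin 3)) (ξ : Fin n → ℝ), Torus.pairing u.1 (fun x => ∑ i, ξ i • b i x) = ∑ i, ξ i *
      Torus.pairing u.1 (b i)) → (∀ x : Fin n → ℝ, ∃ u : Torus.energySpace (Fin 3), IsLevel N u ∧
      (fun i => Torus.pairing u.1 (b i)) = x) → ∀ (ν : ℝ) {f : UnitAddTorus (Fin 3) → EuclideanSpace
      ℝ (Fin 3)}, Torus.IsSmooth f → ∀ (μ₀ : Measure (Torus.energySpace (Fin 3)))
      [IsProbabilityMeasure μ₀], (∀ᵐ u ∂μ₀, IsLevel N u) → (∃ R : ℝ, ∀ᵐ u ∂μ₀, ‖u‖ ≤ R) → (∀ g :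
      UnitAddTorus (Fin 3) → EuclideanSpace ℝ (Fin 3), IsBandTest N g → (∃ u : Torus.energySpace
      (Fin 3), IsLevel N u ∧ Torus.pairing u.1 g ≠ 0) → (∫ u, Torus.pairing u.1 g ∂μ₀) ^ 2 < ∫ u,
      (Torus.pairing u.1 g) ^ 2 ∂μ₀) → (Integrable (fun u : Torus.energySpace (Fin 3) =>
      Torus.nsGeneratorPairing ν f u (Torus.fourierTruncate N (u.1 : UnitAddTorus (Fin 3) →
      EuclideanSpace ℝ (Fin 3)))) μ₀ ∧ ∫ u, Torus.nsGeneratorPairing ν f u (Torus.fourierTruncate N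
      (u.1 : UnitAddTorus (Fin 3) → EuclideanSpace ℝ (Fin 3))) ∂μ₀ = 0) → (Integrable (fun u :
      Torus.energySpace (Fin 3) => Torus.nsGeneratorPairing ν f u (BDSV.curl (Torus.fourierTruncate
      N (u.1 : UnitAddTorus (Fin 3) → EuclideanSpace ℝ (Fin 3))))) μ₀ ∧ ∫ u,
      Torus.nsGeneratorPairing ν f u (BDSV.curl (Torus.fourierTruncate N (u.1 : UnitAddTorus (Fin 3)
      → EuclideanSpace ℝ (Fin 3)))) ∂μ₀ = 0) → (∀ P : MvPolynomial (Fin n) ℝ, P.IsHomogeneous 2 → (∀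
      u : Torus.energySpace (Fin 3), IsLevel N u → Torus.nsGeneratorPairing (d := Fin 3) 0 0 u
      (polyGrad b P u) = 0) → ∃ α β : ℝ, ∀ u : Torus.energySpace (Fin 3), IsLevel N u → ∀ x,
      polyGrad b P u x = (2 * α) • Torus.fourierTruncate N (u.1 : UnitAddTorus (Fin 3) →
      EuclideanSpace ℝ (Fin 3)) x + (2 * β) • BDSV.curl (Torus.fourierTruncate N (u.1 : UnitAddTorus
      (Fin 3) → EuclideanSpace ℝ (Fin 3))) x) → (∀ (P : MvPolynomial (Fin n) ℝ) (d : ℕ),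
      P.totalDegree ≤ d → ∃ Q : MvPolynomial (Fin n) ℝ, Q.totalDegree ≤ d + 1 ∧ (∀ u :
      Torus.energySpace (Fin 3), IsLevel N u → Torus.nsGeneratorPairing ν f u (polyGrad b P u) =
      MvPolynomial.eval (fun i => Torus.pairing u.1 (b i)) Q) ∧ (∀ u : Torus.energySpace (Fin 3),
      IsLevel N u → MvPolynomial.eval (fun i => Torus.pairing u.1 (b i))
      (MvPolynomial.homogeneousComponent (d + 1) Q) = Torus.nsGeneratorPairing (d := Fin 3) 0 0 u
      (polyGrad b (MvPolynomial.homogeneousComponent d P) u))) → ∃ y₀ y : (Fin n →₀ ℕ) → ℝ, (∀ Q :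
      MvPolynomial (Fin n) ℝ, Integrable (fun u : Torus.energySpace (Fin 3) => MvPolynomial.eval
      (fun i => Torus.pairing u.1 (b i)) Q) μ₀ ∧ ∫ u, MvPolynomial.eval (fun i => Torus.pairing u.1
      (b i)) Q ∂μ₀ = Literature.MeasureTheory.Moments.rieszFunctional y₀ Q) ∧ y 0 = 1 ∧
      Literature.MeasureTheory.Moments.IsStrictlyKPositive (Set.univ : Set (Fin n → ℝ)) 4 y ∧ (∀ α :
      Fin n →₀ ℕ, α.degree ≤ 2 → y α = y₀ α) ∧ ∀ P : MvPolynomial (Fin n) ℝ, P.IsHomogeneous 2 → ∀ Q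
      : MvPolynomial (Fin n) ℝ, Q.totalDegree ≤ 3 → (∀ u : Torus.energySpace (Fin 3), IsLevel N u →
      Torus.nsGeneratorPairing ν f u (polyGrad b P u) = MvPolynomial.eval (fun i => Torus.pairing
      u.1 (b i)) Q) → Literature.MeasureTheory.Moments.rieszFunctional y Q = 0 := by
  intro N n b hb hsumband hlin hlev ν f hf μ₀ _ hl₀ hbdd hnd hE hH hQuad hRow
  classical
  -- (0) coordinate moments of `μ₀`
  obtain ⟨R, hR⟩ := hbdd
  have hb2 : ∀ i, MemLp (b i) 2 volume := fun i => (hb i).1.memLp 2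
  have hbs : ∀ i, Torus.IsSmooth (b i) := fun i => (hb i).1
  set y₀ : (Fin n →₀ ℕ) → ℝ := fun α => ∫ u, ∏ i, (Torus.pairing u.1 (b i)) ^ α i ∂μ₀ with hy₀
  have hmom : ∀ Q : MvPolynomial (Fin n) ℝ,
      Integrable (fun u : Torus.energySpace (Fin 3) => eval (fun i => Torus.pairing u.1 (b i)) Q) μ₀ ∧
      ∫ u, eval (fun i => Torus.pairing u.1 (b i)) Q ∂μ₀ = rieszFunctional y₀ Q := fun Q =>
    ⟨integrable_eval_coords hb2 μ₀ hR Q, integral_eval_coords_eq_rieszFunctional hb2 μ₀ hR Q⟩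
  have hy₀0 : y₀ 0 = 1 := by simp [hy₀]
  -- (1) fatten
  have hpd := rieszFunctional_lt_of_nondegenerate μ₀ y₀ (fun Q => (hmom Q).2) hsumband hlin hlev hnd
  obtain ⟨y₁, hy₁pos, hy₁eq⟩ := exists_isStrictlyKPositive_eq_of_degree_le_two n y₀ hy₀0 hpd
  -- (2) exponents of degree 2 and 3, row polynomials of the quadratic monomials
  obtain ⟨T₂, hT₂⟩ := exists_finset_degree_eq n 2
  obtain ⟨T₃, hT₃⟩ := exists_finset_degree_eq n 3
  have hQα : ∀ α : ↥T₂, ∃ Q : MvPolynomial (Fin n) ℝ, Q.totalDegree ≤ 3 ∧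
      (∀ u : Torus.energySpace (Fin 3), IsLevel N u →
        Torus.nsGeneratorPairing ν f u (polyGrad b (monomial α.1 (1 : ℝ)) u) =
          eval (fun i => Torus.pairing u.1 (b i)) Q) ∧
      (∀ u : Torus.energySpace (Fin 3), IsLevel N u →
        eval (fun i => Torus.pairing u.1 (b i)) (homogeneousComponent 3 Q) =
          Torus.nsGeneratorPairing (d := Fin 3) 0 0 u (polyGrad b (monomial α.1 (1 : ℝ)) u)) := by
    intro α
    obtain ⟨Q, h1, h2, h3⟩ := hRow (monomial α.1 1) 2
      ((totalDegree_monomial_le _ _).trans ((finsupp_degree_eq_sum α.1).symm.trans_le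
        ((hT₂ α.1).mp α.2).le))
    refine ⟨Q, h1, h2, fun u hu => ?_⟩
    rw [h3 u hu, homogeneousComponent_eq_self (isHomogeneous_monomial _ ((hT₂ α.1).mp α.2))]
  choose Qb hQdeg hQrow hQtop using hQα
  -- (3) the kernel step: `a ⊥ ker cᵀ`
  set c : ↥T₂ → ↥T₃ → ℝ := fun α β => (Qb α).coeff β.1 with hc
  set a : ↥T₂ → ℝ := fun α => rieszFunctional y₁ (Qb α) with ha
  have hkerH : ∀ p : ↥T₂ → ℝ, (∀ β, ∑ α, p α * c α β = 0) → ∑ α, p α * a α = 0 := by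
    intro p hp
    set P : MvPolynomial (Fin n) ℝ := ∑ α, p α • monomial α.1 (1 : ℝ) with hPdef
    set Q : MvPolynomial (Fin n) ℝ := ∑ α, p α • Qb α with hQdef
    have hP : P.IsHomogeneous 2 := IsHomogeneous.sum _ _ _ fun α _ => by
      rw [smul_monomial, smul_eq_mul, mul_one]
      exact isHomogeneous_monomial _ ((hT₂ α.1).mp α.2)
    have hQ3 : Q.totalDegree ≤ 3 :=
      totalDegree_finsetSum_le fun α _ => (totalDegree_smul_le _ _).trans (hQdeg α)
    have hQrow' : ∀ u : Torus.energySpace (Fin 3), IsLevel N u →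
        Torus.nsGeneratorPairing ν f u (polyGrad b P u) = eval (fun i => Torus.pairing u.1 (b i)) Q := by
      intro u hu
      rw [hPdef, hQdef, nsGeneratorPairing_polyGrad_sum_smul ν hf hbs, map_sum]
      simp_rw [smul_eval, hQrow _ u hu]
    have hQtop' : ∀ u : Torus.energySpace (Fin 3), IsLevel N u →
        eval (fun i => Torus.pairing u.1 (b i)) (homogeneousComponent 3 Q) =
          Torus.nsGeneratorPairing (d := Fin 3) 0 0 u (polyGrad b P u) := by
      intro u hu
      have hz : Torus.IsSmooth (0 : UnitAddTorus (Fin 3) → EuclideanSpace ℝ (Fin 3)) :=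
        Torus.isSmooth_const 0
      rw [hPdef, hQdef, nsGeneratorPairing_polyGrad_sum_smul 0 hz hbs, map_sum, map_sum]
      simp_rw [LinearMap.map_smul, smul_eval, hQtop _ u hu]
    have hker : homogeneousComponent 3 Q = 0 := by
      refine MvPolynomial.ext _ _ fun β => ?_
      rw [coeff_homogeneousComponent, coeff_zero]
      split_ifs with h3
      · have h := hp ⟨β, (hT₃ β).mpr h3⟩
        simp only [hc] at h
        rw [hQdef, coeff_sum]
        simpa [coeff_smul] using h
      · rfl
    have h0 := rieszFunctional_eq_zero_of_homogeneousComponent_eq_zero ν hf μ₀ hl₀ y₀ y₁ hmom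
      (fun α hα => hy₁eq α (by omega)) hE hH hQuad P hP Q hQ3 hQrow' hQtop' hker
    rw [hQdef, rieszFunctional_sum_smul] at h0
    exact h0
  obtain ⟨s, hs⟩ := exists_eq_sum_mul_of_forall_sum_eq_zero c a hkerH
  -- (4) the shift `S = -s` of the third moments and the inflation factor `Λ`
  set S : (Fin n →₀ ℕ) → ℝ := fun β => if h : β.degree = 3 then -(s ⟨β, (hT₃ β).mpr h⟩) else 0
    with hSdef
  obtain ⟨Λ₀, hΛ⟩ := exists_forall_le_isStrictlyKPositive_shift n y₁ S (hy₁pos 4)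
  refine ⟨y₀, fun α => if α.degree ≤ 2 then y₁ α else if α.degree = 3 then y₁ α + S α else Λ₀ * y₁ α,
    hmom, ?_, hΛ Λ₀ le_rfl, fun α hα => ?_, ?_⟩
  · simp [hy₁eq 0 (by simp), hy₀0]
  · simp [hα, hy₁eq α hα]
  -- (5) every quadratic row vanishes
  intro P hP Q hQ3 hrowQ
  set p : ↥T₂ → ℝ := fun α => P.coeff α.1 with hpdef
  have hPsum : P = ∑ α : ↥T₂, p α • monomial α.1 (1 : ℝ) :=
    eq_sum_smul_monomial_of_isHomogeneous hT₂ P hP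
  -- `Q` is the same combination of the `Q_α` (both compute the row; coordinates are onto)
  have hQQ : Q = ∑ α, p α • Qb α := by
    refine MvPolynomial.funext fun x => ?_
    obtain ⟨u, hu, hux⟩ := hlev x
    rw [← hux, ← hrowQ u hu, hPsum, nsGeneratorPairing_polyGrad_sum_smul ν hf hbs, map_sum]
    simp_rw [smul_eval, hQrow _ u hu]
  rw [hQQ, rieszFunctional_sum_smul]
  refine Finset.sum_eq_zero fun α _ => ?_
  -- `L_{y_Λ}(Q_α) = a α - Σ_β c α β s β = 0`
  have hsplit := rieszFunctional_eq_of_degree_three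
    (fun α => if α.degree ≤ 2 then y₁ α else if α.degree = 3 then y₁ α + S α else Λ₀ * y₁ α) y₁ S
    (fun β hβ => by
      have : β.degree ≤ 2 := by omega
      simp [this])
    (fun β hβ => by simp [hβ]) (Qb α) (hQdeg α)
  have hshift : ∑ β ∈ (Qb α).support, (if β.degree = 3 then (Qb α).coeff β * S β else 0) =
      -∑ β, c α β * s β := by
    rw [← Finset.sum_filter]
    -- both sides are sums over the degree-3 exponents with nonzero coefficient
    have hsub : (Qb α).support.filter (fun β => β.degree = 3) ⊆ T₃ := fun β hβ =>
      (hT₃ β).mpr (Finset.mem_filter.mp hβ).2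
    have hext : ∑ β ∈ (Qb α).support.filter (fun β => β.degree = 3), (Qb α).coeff β * S β =
        ∑ β ∈ T₃, (Qb α).coeff β * S β := by
      refine Finset.sum_subset hsub fun β hβT hβn => ?_
      have h3 : β.degree = 3 := (hT₃ β).mp hβT
      have hcoeff : (Qb α).coeff β = 0 := by
        by_contra hne
        exact hβn (Finset.mem_filter.mpr ⟨mem_support_iff.mpr hne, h3⟩)
      rw [hcoeff, zero_mul]
    rw [hext, ← Finset.sum_coe_sort T₃, ← Finset.sum_neg_distrib]
    refine Finset.sum_congr rfl fun β _ => ?_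
    obtain ⟨β, hβ⟩ := β
    have h3 : β.degree = 3 := (hT₃ β).mp hβ
    simp only [hSdef, hc, dif_pos h3]
    ring
  have haα : rieszFunctional y₁ (Qb α) = ∑ β, c α β * s β := hs α
  rw [hsplit, hshift, haα]
  ring

end Summit.AnomalousDissipation.AnomalousDissipation.Theorems.MomentParityQuarticGate
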